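import Summits.BirchSwinnertonDyer.BirchSwinnertonDyer.Theorems.GenusKolyvaginAtTwoVisiblePairAtTwoCasselsTateValueTwin
import Literature.NumberTheory.EllipticCurves.HeegnerPointsKolyvaginVisibleDescentPairValueProofs
import HarnessLib

/-!
# Route `GenusKolyvaginAtTwo`, crux `KolyvaginExactAtTwo` (22137) → Q3-inner: the `ℚ`-pair capstone with the
# Cassels–Tate block DISCHARGED modulo the construction inputs and McCallum's local Lemma 5.3

Seat `bsd-line-gk2-p2` g12 (cell `bsd-f1-sign2`). THEOREMS ONLY (no definition, no named fact, no `sorry`).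

`selmer_eq_and_card_selmer_twin_eq_of_localTerms`: the capstone `selmer_eq_and_card_selmer_twin_eq_of_input_pair`
(p648690) at an even level `M = L + L` with `2M₀ ≤ L`, whose EIGHT opaque Cassels–Tate hypotheses
(`P₁ P₂ halt₁ halt₂ hPx hnd₁ hnd₂ hCTV`) are replaced by STANDARD inputs: the tree's level-`2^L` Cassels–Tate pairings
`ctLevelPairing` of `E/ℚ` and `E^{(d_K)}/ℚ` (Weil-pairing data, local invariant maps `inv` with reciprocity `hPT'`,
`hH3 : Ш³(ℚ, μ) = 0`) with their level-pairing property `hB₁`, `hB₂` (Milne I Thm. 6.13(a) + Cassels' alternation at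
the even level), `x ∈ δ(E(ℚ))`, and McCallum's Lemma 5.3 for the local term at `λ` of each member (`hloc₁`, `hloc₂`,
cochain currency — the same residue as the odd-`p` file `HeegnerPointsKolyvaginPrimaryOrderHCTVProofs`). Assembly of
`…CasselsTatePullback` (`_of_torsion`), `…CasselsTateValue(Twin)` and `Literature.….hCTV_of_members`.

BSD is not proved by any of this.

References: [McCallumLMS1991] §2 (1), Prop. 4.7, Lemma 5.3, Prop. 5.2, Thm. 5.4, Cor. 5.6; [MilneADT2006] I §6
Prop. 6.9, Thm. 6.13(a); [Kolyvagin1989Izv] §3.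
-/

set_option linter.dupNamespace false -- tree convention: `Summit.BirchSwinnertonDyer.BirchSwinnertonDyer.Theorems` (summit = sub-problem)
set_option autoImplicit false

noncomputable section

open scoped Classical
open scoped AddSubgroup

universe u

namespace Summit.BirchSwinnertonDyer.BirchSwinnertonDyer.Theorems.GenusExact.VisiblePairAtTwo

open WeierstrassCurve NumberField IsDedekindDomain Field Function Rat.HeightOneSpectrum
open Literature.NumberTheory.EllipticCurves Literature.NumberTheory.GaloisRepresentations
open Literature.NumberTheory.GaloisCohomology
open Literature.NumberTheory.GaloisRepresentations.DiscreteGaloisModule (mu)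
open Literature.NumberTheory.EllipticCurves.KolyvaginDescent
open Literature.GroupTheory.FiniteAbelian

/-! ## §4. The capstone with the Cassels–Tate block DISCHARGED modulo the construction inputs and the two
local terms -/

section Capstone

variable {W : WeierstrassCurve ℚ} [W.IsElliptic] [W.IsGloballyMinimal] {K : Type} [Field K] [NumberField K]
  {L : ℕ} {θ : K} {hθ : θ ∉ Set.range (algebraMap ℚ K)}
  {hθsq : θ ^ 2 = algebraMap ℚ K ((NumberField.discr K : ℤ) : ℚ)} [(twin W K).IsElliptic]

/-- **Exactness of the `ℚ`-pair instance, Cassels–Tate block discharged**: as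
`selmer_eq_and_card_selmer_twin_eq_of_input_pair` (p648690) at the even level `M = L + L` with `2M₀ ≤ L`, but
with ALL EIGHT Cassels–Tate hypotheses (`P₁ P₂ halt₁ halt₂ hPx hnd₁ hnd₂ hCTV`) REPLACED by: the level-`2^L`
Cassels–Tate pairings of `E/ℚ` and `E^{(d_K)}/ℚ` in the tree's construction (`ctLevelPairing`, Milne I Prop. 6.9
with auxiliary level `2^L · 2^L`: Weil-pairing data `e₁`, `e₂`, a family `inv` of local invariant maps with the
reciprocity law `hPT'`, `hH3 : Ш³(ℚ, μ) = 0`) together with their LEVEL-PAIRING property (`hB₁`, `hB₂`: alternating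
with kernel `Ш[2^L] ∩ 2^L Ш` — Milne I Thm. 6.13(a) + Cassels' alternation; for odd levels the tree's
`isLevelPairing_ctLevelPairing_of_inputs`), `x ∈ δ(E(ℚ))` (`hx`), and McCallum's LEMMA 5.3 at `λ` for the local term of
each member in cochain currency (`hloc₁`, `hloc₂`). The maps `ι_i : Sel_{2^M} → Ш[2^L]` are constructed
(`exists_selmerToSha_of_input`), non-degeneracy comes from Claims A/B + Kummer (`…CasselsTatePullback`), the value
formula from Prop. 4.7 member by member (`hV₁_of_localTerm`, `hV₂_of_localTerm`, `hCTV_of_members`), fed into the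
torsion-restricted capstone `selmer_eq_and_card_selmer_twin_eq_of_levelPairings_of_torsion`.
[cite: McCallumLMS1991, §2 (1), Prop. 4.7, Lemma 5.3, Prop. 5.2, Thm. 5.4, Cor. 5.6]
[cite: MilneADT2006, Ch. I §6, Prop. 6.9, Thm. 6.13(a)] [cite: Kolyvagin1989Izv, §3] -/
theorem selmer_eq_and_card_selmer_twin_eq_of_localTerms (I : Input W K (L + L) hθ hθsq) (I₁ : Input W K 1 hθ hθsq)
    (hcm : ¬ W.HasCM) (hΔ : W.Δ < 0) (hK : IsImaginaryQuadratic K) (hodd : Odd (NumberField.discr K))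
    (hns : ¬ IsSquare ((NumberField.discr K : ℚ) * -|W.Δ|))
    (hρ : ∀ n : ℕ, W.HasSurjectiveModNGaloisRep (2 ^ n : ℕ)) (hL : 2 * I.M₀ ≤ L) (hL1 : 1 ≤ L)
    -- the Cassels–Tate construction inputs, both members, level `2^L` (auxiliary level `2^L · 2^L = 2^M`)
    (e₁ : geomTorsion W ((2 ^ L * 2 ^ L : ℕ) : ℤ) → geomTorsion W ((2 ^ L * 2 ^ L : ℕ) : ℤ) → AlgebraicClosure ℚ)
    (hμ₁ : ∀ S T, e₁ S T ^ (2 ^ L * 2 ^ L) = 1)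
    (hadd₁₁ : ∀ S₁ S₂ T, e₁ (S₁ + S₂) T = e₁ S₁ T * e₁ S₂ T)
    (hadd₂₁ : ∀ S T₁ T₂, e₁ S (T₁ + T₂) = e₁ S T₁ * e₁ S T₂)
    (hgal₁ : ∀ (σ : absoluteGaloisGroup ℚ) (S T : geomTorsion W ((2 ^ L * 2 ^ L : ℕ) : ℤ)),
      σ • e₁ S T = e₁ (σ • S) (σ • T))
    (halt₁ : ∀ T, e₁ T T = 1)
    (e₂ : geomTorsion (twin W K) ((2 ^ L * 2 ^ L : ℕ) : ℤ) → geomTorsion (twin W K) ((2 ^ L * 2 ^ L : ℕ) : ℤ) →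
      AlgebraicClosure ℚ)
    (hμ₂ : ∀ S T, e₂ S T ^ (2 ^ L * 2 ^ L) = 1)
    (hadd₁₂ : ∀ S₁ S₂ T, e₂ (S₁ + S₂) T = e₂ S₁ T * e₂ S₂ T)
    (hadd₂₂ : ∀ S T₁ T₂, e₂ S (T₁ + T₂) = e₂ S T₁ * e₂ S T₂)
    (hgal₂ : ∀ (σ : absoluteGaloisGroup ℚ) (S T : geomTorsion (twin W K) ((2 ^ L * 2 ^ L : ℕ) : ℤ)),
      σ • e₂ S T = e₂ (σ • S) (σ • T))
    (halt₂ : ∀ T, e₂ T T = 1)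
    (inv : LocalInvariants ℚ (2 ^ L * 2 ^ L)) (hPT' : inv.SumInvLocalizationEqZero)
    (hH3 : ∀ c : galoisCohomology (mu ℚ (2 ^ L * 2 ^ L)) 3,
      (∀ v : Place ℚ, galoisCohomology.localization (mu ℚ (2 ^ L * 2 ^ L)) v 3 c = 0) → c = 0)
    (hB₁ : IsLevelPairing (2 ^ L) (ctLevelPairing W (2 ^ L) e₁ hμ₁ hadd₁₁ hadd₂₁ hgal₁ inv halt₁ hPT' hH3
      (localTerm_finite_support (W := W) (m := 2 ^ L) (e := e₁) (hμ := hμ₁) (hadd₁ := hadd₁₁) (hadd₂ := hadd₂₁)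
        (hgal := hgal₁) halt₁ inv)))
    (hB₂ : IsLevelPairing (2 ^ L) (ctLevelPairing (twin W K) (2 ^ L) e₂ hμ₂ hadd₁₂ hadd₂₂ hgal₂ inv halt₂ hPT' hH3
      (localTerm_finite_support (W := twin W K) (m := 2 ^ L) (e := e₂) (hμ := hμ₂) (hadd₁ := hadd₁₂)
        (hadd₂ := hadd₂₂) (hgal := hgal₂) halt₂ inv)))
    (hx : torsionH1ToH1 W (lvl (L + L)) I.x = 0)
    -- McCallum's Lemma 5.3 at `λ`, cochain currency, both members (displayed)
    (hloc₁ : ∀ ℓ m' : ℕ, (hℓ : kolPrime W K (L + L) ℓ) → KolSupp (kolPrime W K (L + L)) (ℓ * m') → ¬ ℓ ∣ m' →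
      Odd m'.primeFactors.card →
      ∀ (j N a b : ℕ) (t : galH1Torsion W (lvl (L + L))), t ∈ selmerGroup W (lvl (L + L)) →
      ((2 : ℤ) ^ j) • I.c₁ (ℓ * m') ∈ selmerGroup W (lvl (L + L)) →
      ((2 : ℤ) ^ N) • t = 0 → ((2 : ℤ) ^ (2 * I.M₀)) • t = 0 →
      (∀ q ∈ m'.primeFactors, t ∈ a₁ W (L + L) q) → L + L - I.M₀ ≤ j → N + I.M₀ ≤ L + L → N ≤ j →
      a + b + 1 = N → ((2 : ℤ) ^ (a + (j - N))) • I.c₂ m' ∉ a₂ W K (L + L) ℓ →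
      ((2 : ℤ) ^ b) • t ∉ a₁ W (L + L) ℓ →
      ∀ D : FirstCaseData W (2 ^ L),
        D.b₁ = torsionH1OfDvd W (lvl_dvd_sq L) (((2 : ℤ) ^ (j - L)) • I.c₁ (ℓ * m')) →
        galoisCohomology.map (inclKD W (2 ^ L) (2 ^ L)) 1 D.b' = torsionH1OfDvd W (lvl_dvd_sq L) t →
        D.localTerm e₁ hμ₁ hadd₁₁ hadd₂₁ hgal₁ inv (Sum.inr (primesEquiv.symm ⟨ℓ, hℓ.1⟩)) ≠ 0)
    (hloc₂ : ∀ ℓ m' : ℕ, (hℓ : kolPrime W K (L + L) ℓ) → KolSupp (kolPrime W K (L + L)) (ℓ * m') → ¬ ℓ ∣ m' →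
      Even m'.primeFactors.card →
      ∀ (j N a b : ℕ) (t : galH1Torsion (twin W K) (lvl (L + L))), t ∈ selmerGroup (twin W K) (lvl (L + L)) →
      ((2 : ℤ) ^ j) • I.c₂ (ℓ * m') ∈ selmerGroup (twin W K) (lvl (L + L)) →
      ((2 : ℤ) ^ N) • t = 0 → ((2 : ℤ) ^ (2 * I.M₀)) • t = 0 →
      (∀ q ∈ m'.primeFactors, t ∈ a₂ W K (L + L) q) → L + L - I.M₀ ≤ j → N + I.M₀ ≤ L + L → N ≤ j →
      a + b + 1 = N → ((2 : ℤ) ^ (a + (j - N))) • I.c₁ m' ∉ a₁ W (L + L) ℓ →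
      ((2 : ℤ) ^ b) • t ∉ a₂ W K (L + L) ℓ →
      ∀ D : FirstCaseData (twin W K) (2 ^ L),
        D.b₁ = torsionH1OfDvd (twin W K) (lvl_dvd_sq L) (((2 : ℤ) ^ (j - L)) • I.c₂ (ℓ * m')) →
        galoisCohomology.map (inclKD (twin W K) (2 ^ L) (2 ^ L)) 1 D.b' =
          torsionH1OfDvd (twin W K) (lvl_dvd_sq L) t →
        D.localTerm e₂ hμ₂ hadd₁₂ hadd₂₂ hgal₂ inv (Sum.inr (primesEquiv.symm ⟨ℓ, hℓ.1⟩)) ≠ 0)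
    -- the shallow certificate, in class form, and the remaining level-`2` inputs
    {ℓ₀ : ℕ} (hkol₀ : kolPrime W K 1 ℓ₀) (hy0 : I₁.c₂ ℓ₀ ≠ 0) (h0 : I₁.c₁ 1 = 0)
    (h44ord : ∀ ℓ, kolPrime W K (L + L) ℓ → ℓ ≠ ℓ₀ →
      (I₁.c₁ (ℓ * ℓ₀) ∈ a₁ W 1 ℓ₀ ↔ I₁.c₂ ℓ ∈ a₂ W K 1 ℓ₀))
    (hι : ∀ ℓ, kolPrime W K (L + L) ℓ → torsionH1OfDvd (twin W K) (lvl_one_dvd_lvl (hL1.trans (Nat.le_add_right L L)))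
      (I₁.c₂ ℓ) = ((2 : ℤ) ^ (L + L - 1)) • I.c₂ ℓ) :
    selmerGroup W (lvl (L + L)) = AddSubgroup.zmultiples I.x ∧
      Nat.card (selmerGroup (twin W K) (lvl (L + L))) = 2 ^ (2 * I.M₀) := by
  have hρ2 : W.HasSurjectiveModNGaloisRep 2 := by simpa using hρ 1
  obtain ⟨ι₁, hι₁⟩ := exists_selmerToSha_of_input I hx hL
  obtain ⟨ι₂, hι₂⟩ := exists_selmerToSha_twin_of_input I (L := L) (by omega)
  exact selmer_eq_and_card_selmer_twin_eq_of_levelPairings_of_torsion I I₁ hcm hΔ hK hodd hns hρ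
    (hL1.trans (Nat.le_add_right L L)) hL (Nat.le_add_right L L) _ hB₁ ι₁ hι₁ _ hB₂ ι₂ hι₂ hx
    ((visiblePair I).hCTV_of_members _ _
      (hV₁_of_localTerm I hρ2 hx hL e₁ hμ₁ hadd₁₁ hadd₂₁ hgal₁ halt₁ inv hPT' hH3 ι₁ hι₁ hloc₁)
      (hV₂_of_localTerm I hρ2 hL e₂ hμ₂ hadd₁₂ hadd₂₂ hgal₂ halt₂ inv hPT' hH3 ι₂ hι₂ hloc₂))
    (by omega) hkol₀ hy0 h0 h44ord hι

end Capstone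



end Summit.BirchSwinnertonDyer.BirchSwinnertonDyer.Theorems.GenusExact.VisiblePairAtTwo

end
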